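/-
Copyright (c) 2026. All rights reserved.
Released under Apache 2.0 license as described in the file LICENSE.
Authors: abc-iut cell, seat abc-iut-L4-t14 (gen 3; proof-only companion of `LocCategoryGroupModel.lean`:
hypothesis (Z) as ONE centraliser statement in the profinite completion of the normaliser).
-/
import Literature.AnabelianGeometry.AbsoluteAnabelian.LocCategoryGroupModel
import Mathlib.Topology.Algebra.Category.ProfiniteGrp.Completion
import HarnessLib

/-!
# `Loc(N, Γ)` is id-rigid as soon as `Γ̂` has trivial centraliser in the completion of `N_N(Γ)`

S. Mochizuki, *Topics in absolute anabelian geometry III*, proof of Prop 4.2 (i), kurims manuscript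
p. 106 l. 14–19 (`paper:url-5493eb38cbb7`; bib key `MochizukiAbsTopIII2015`): the id-rigidity of the
category of finite étale localizations `Loc_R(X)` "follows immediately from the slimness assertion of
Lemma 4.3".  PROOF-ONLY companion (no new notion) of abc-iut-L4-t14's `LocCategoryGroupModel.lean`
(group model `Loc(N, Γ)`: objects the finite-index `Λ ≤ Γ`, morphisms the `g ∈ N` with
`g Λ₁ g⁻¹ ≤ Λ₂` modulo `Λ₂`; `isIdRigid_of_centralFamiliesTrivial`: hypothesis (Z) ⟹ id-rigid).

Here hypothesis (Z) is derived from ONE statement about a genuine profinite group, Mathlib's profinite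
completion `M̂ := ProfiniteGrp.ProfiniteCompletion.completion M` of the normaliser `M := N_N(Γ)`:

* `LocObj.centralFamiliesTrivial_of_completion_normalizer` — if `[M : Γ] < ∞` and **every element of
  `M̂` commuting with the image `η(Γ)` is trivial** (the centraliser of `Γ̂ = closure of η(Γ)`, an open
  subgroup of `M̂`, is trivial — in particular if `M̂` is SLIM), then (Z) holds: a compatible `Γ`-central
  family `(x_Λ)` defines the element `(x_{K ∩ Γ} K)_K` of `M̂ = lim M/K`, which commutes with `η(Γ)`;
* `LocObj.isIdRigid_of_completion_normalizer` — hence `Loc(N, Γ)` is id-rigid.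

For `Γ = π₁(X) ≤ N = Isom(ℍ)` (`X` a hyperbolic Riemann surface of finite type, `M/Γ = Aut(X)` finite)
`M̂` is the profinite completion of the NEC/Fuchsian group `M`, i.e. `Π` of the quotient orbicurve
`[X/Aut X]` — so the campaign-L residual of GAP row G-L4t14-R1 at the `EA` side is exactly print's
Lemma 4.3 for that orbicurve (slim ⟹ trivial centraliser of the open subgroup `Γ̂`).  Not proved here.

Refereed pre-IUT material; nothing here bears on [IUTchIII] Cor. 3.12 or takes a side; typed ≠ proved;
model ≠ reconstruction.
-/

set_option autoImplicit false

namespace Literature.AnabelianGeometry.AbsoluteAnabelian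

namespace LocObj

open _root_.CategoryTheory
open _root_.ProfiniteGrp.ProfiniteCompletion (completion etaFn)

universe u

variable {N : Type u} [Group N] {Γ : Subgroup N}

/-- **(Z) ⟸ trivial centraliser of `η(Γ)` in the profinite completion of `M = N_N(Γ)`** (given
`[M : Γ] < ∞`).  Print: "follows immediately from the slimness assertion of Lemma 4.3" — slimness of
`M̂ = Π_{[X/Aut X]}` gives the hypothesis, `Γ̂` being open in `M̂`.
[cite: MochizukiAbsTopIII2015, Proposition 4.2 (i) proof p.106] -/
theorem centralFamiliesTrivial_of_completion_normalizer
    [hΓM : (Γ.subgroupOf (Subgroup.normalizer (Γ : Set N))).FiniteIndex]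
    (h : ∀ y : completion (GrpCat.of (Subgroup.normalizer (Γ : Set N))),
      (∀ γ : Subgroup.normalizer (Γ : Set N), (γ : N) ∈ Γ →
        y * etaFn (GrpCat.of (Subgroup.normalizer (Γ : Set N))) γ =
          etaFn (GrpCat.of (Subgroup.normalizer (Γ : Set N))) γ * y) → y = 1) :
    CentralFamiliesTrivial Γ := by
  classical
  intro x hxN hcompat hcentral Λ₀ hΛ₀
  -- notation
  set M : Subgroup N := Subgroup.normalizer (Γ : Set N) with hM
  have hΓM' : Γ ≤ M := Subgroup.le_normalizer
  -- the object `K ∩ Γ` attached to a finite-index normal subgroup `K` of `M`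
  have hfin : ∀ K : FiniteIndexNormalSubgroup M,
      ((K.toSubgroup.map M.subtype ⊓ Γ).subgroupOf Γ).FiniteIndex := by
    intro K
    rw [Subgroup.inf_subgroupOf_right]
    refine ⟨fun h0 => ?_⟩
    have h1 : (K.toSubgroup.map M.subtype).relIndex M ≠ 0 := by
      rw [Subgroup.relIndex, ← Subgroup.comap_subtype,
        Subgroup.comap_map_eq_self_of_injective M.subtype_injective]
      exact Subgroup.FiniteIndex.index_ne_zero
    exact h1 (Subgroup.relIndex_eq_zero_of_le_right hΓM' h0)
  let Λ : FiniteIndexNormalSubgroup M → LocObj Γ := fun K =>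
    { toSubgroup := K.toSubgroup.map M.subtype ⊓ Γ
      le := inf_le_right
      finiteIndex := hfin K }
  have hΛmem : ∀ (K : FiniteIndexNormalSubgroup M) (y : N),
      y ∈ (Λ K).toSubgroup ↔ (∃ hy : y ∈ M, (⟨y, hy⟩ : M) ∈ K.toSubgroup) ∧ y ∈ Γ := by
    intro K y
    change y ∈ K.toSubgroup.map M.subtype ⊓ Γ ↔ _
    rw [Subgroup.mem_inf, Subgroup.mem_map]
    constructor
    · rintro ⟨⟨k, hk, rfl⟩, hy⟩
      exact ⟨⟨k.2, by simpa using hk⟩, hy⟩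
    · rintro ⟨⟨hy, hk⟩, hyΓ⟩
      exact ⟨⟨⟨y, hy⟩, hk, rfl⟩, hyΓ⟩
  have hΛnormal : ∀ K : FiniteIndexNormalSubgroup M, (Λ K).IsNormal := by
    intro K γ hγ y hy
    rw [hΛmem] at hy ⊢
    obtain ⟨⟨hyM, hyK⟩, hyΓ⟩ := hy
    refine ⟨⟨M.mul_mem (M.mul_mem (hΓM' hγ) hyM) (M.inv_mem (hΓM' hγ)), ?_⟩,
      Γ.mul_mem (Γ.mul_mem hγ hyΓ) (Γ.inv_mem hγ)⟩
    convert K.isNormal'.conj_mem ⟨y, hyM⟩ hyK ⟨γ, hΓM' hγ⟩ using 1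
    exact Subtype.ext (by simp only [Subgroup.coe_mul, Subgroup.coe_inv])
  have hΛmono : ∀ {K K' : FiniteIndexNormalSubgroup M}, K ≤ K' →
      (Λ K).toSubgroup ≤ (Λ K').toSubgroup := by
    intro K K' hKK' y hy
    rw [hΛmem] at hy ⊢
    obtain ⟨⟨hyM, hyK⟩, hyΓ⟩ := hy
    exact ⟨⟨hyM, hKK' hyK⟩, hyΓ⟩
  -- the element of the completion
  have hxM : ∀ K : FiniteIndexNormalSubgroup M, x (Λ K) ∈ M := fun K => hxN _ (hΛnormal K)
  let y : completion (GrpCat.of M) :=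
    ⟨fun K => (QuotientGroup.mk (⟨x (Λ K), hxM K⟩ : M) : M ⧸ K.toSubgroup), by
      intro K K' π
      change QuotientGroup.map K.toSubgroup K'.toSubgroup (MonoidHom.id _) π.le
          (QuotientGroup.mk (⟨x (Λ K), hxM K⟩ : M) : M ⧸ K.toSubgroup) =
        (QuotientGroup.mk (⟨x (Λ K'), hxM K'⟩ : M) : M ⧸ K'.toSubgroup)
      rw [QuotientGroup.map_mk, MonoidHom.id_apply, QuotientGroup.eq]
      -- `x_K⁻¹ x_{K'} ∈ K'` from compatibility `x_{K'} x_K⁻¹ ∈ Λ K' ⊆ K'` and normality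
      have hc := hcompat (Λ K') (Λ K) (hΛnormal K') (hΛnormal K) (hΛmono π.le)
      rw [hΛmem] at hc
      obtain ⟨⟨hcM, hcK⟩, -⟩ := hc
      have h2 := K'.isNormal'.conj_mem _ hcK ((⟨x (Λ K), hxM K⟩ : M)⁻¹)
      have e : ((⟨x (Λ K), hxM K⟩ : M)⁻¹ * ⟨x (Λ K') * (x (Λ K))⁻¹, hcM⟩ *
          ((⟨x (Λ K), hxM K⟩ : M)⁻¹)⁻¹ : M) = (⟨x (Λ K), hxM K⟩ : M)⁻¹ * ⟨x (Λ K'), hxM K'⟩ := by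
        apply Subtype.ext
        simp only [Subgroup.coe_mul, Subgroup.coe_inv]
        group
      rwa [e] at h2⟩
  -- it commutes with `η(Γ)`
  have hy : ∀ γ : M, (γ : N) ∈ Γ →
      y * etaFn (GrpCat.of M) γ = etaFn (GrpCat.of M) γ * y := by
    intro γ hγ
    apply ProfiniteGrp.limit_ext
    intro K
    change (QuotientGroup.mk (⟨x (Λ K), hxM K⟩ : M) : M ⧸ K.toSubgroup) * QuotientGroup.mk γ =
      QuotientGroup.mk γ * QuotientGroup.mk (⟨x (Λ K), hxM K⟩ : M)
    rw [← QuotientGroup.mk_mul, ← QuotientGroup.mk_mul, QuotientGroup.eq]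
    -- `(x γ)⁻¹ (γ x) ∈ K` from `x γ x⁻¹ γ⁻¹ ∈ Λ K ⊆ K`
    have hc := hcentral (Λ K) (hΛnormal K) γ hγ
    rw [hΛmem] at hc
    obtain ⟨⟨hcM, hcK⟩, -⟩ := hc
    have h1 := K.toSubgroup.inv_mem hcK
    have h2 := K.isNormal'.conj_mem _ h1 ((γ * ⟨x (Λ K), hxM K⟩ : M)⁻¹)
    have e : ((γ * ⟨x (Λ K), hxM K⟩ : M)⁻¹ *
        (⟨x (Λ K) * (γ : N) * (x (Λ K))⁻¹ * (γ : N)⁻¹, hcM⟩ : M)⁻¹ *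
        ((γ * ⟨x (Λ K), hxM K⟩ : M)⁻¹)⁻¹ : M) =
        (⟨x (Λ K), hxM K⟩ * γ : M)⁻¹ * (γ * ⟨x (Λ K), hxM K⟩) := by
      apply Subtype.ext
      simp only [Subgroup.coe_mul, Subgroup.coe_inv]
      group
    rw [e] at h2
    exact h2
  -- hence `y = 1`: every `x_{K ∩ Γ}` lies in `K`
  have hy1 := h y hy
  have hxK : ∀ K : FiniteIndexNormalSubgroup M, (⟨x (Λ K), hxM K⟩ : M) ∈ K.toSubgroup := by
    intro K
    have e := congrArg (fun z : completion (GrpCat.of M) => z.val K) hy1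
    change (QuotientGroup.mk (⟨x (Λ K), hxM K⟩ : M) : M ⧸ K.toSubgroup) = 1 at e
    exact (QuotientGroup.eq_one_iff _).mp e
  -- the normal core of `Λ₀` in `M` is a finite-index normal subgroup of `M` inside `Λ₀`
  haveI : (Λ₀.toSubgroup.subgroupOf M).FiniteIndex := by
    refine ⟨fun h0 => ?_⟩
    have h1 : Λ₀.toSubgroup.relIndex Γ ≠ 0 := by
      haveI := Λ₀.finiteIndex; exact Subgroup.FiniteIndex.index_ne_zero
    have h2 : Γ.relIndex M ≠ 0 := Subgroup.FiniteIndex.index_ne_zero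
    have h3 := Subgroup.relIndex_mul_relIndex (H := Λ₀.toSubgroup) (K := Γ) (L := M) Λ₀.le hΓM'
    rw [show Λ₀.toSubgroup.relIndex M = 0 from h0, mul_eq_zero] at h3
    rcases h3 with h3 | h3
    · exact h1 h3
    · exact h2 h3
  let K₀ : FiniteIndexNormalSubgroup M := { toSubgroup := (Λ₀.toSubgroup.subgroupOf M).normalCore }
  have hK₀le : (Λ K₀).toSubgroup ≤ Λ₀.toSubgroup := by
    intro y hy
    rw [hΛmem] at hy
    obtain ⟨⟨hyM, hyK⟩, -⟩ := hy
    exact Subgroup.mem_subgroupOf.mp (Subgroup.normalCore_le _ hyK)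
  have hx₀ : x (Λ K₀) ∈ Λ₀.toSubgroup :=
    Subgroup.mem_subgroupOf.mp (Subgroup.normalCore_le _ (hxK K₀))
  have hc := hcompat Λ₀ (Λ K₀) hΛ₀ (hΛnormal K₀) hK₀le
  have := Λ₀.toSubgroup.mul_mem hc hx₀
  simpa using this

/-- **`Loc(N, Γ)` is id-rigid as soon as `η(Γ)` has trivial centraliser in the profinite completion of
`N_N(Γ)`** (with `[N_N(Γ) : Γ] < ∞`): the composite of the above with
`isIdRigid_of_centralFamiliesTrivial`.  In print: the id-rigidity of `Loc_R(X)` from Lemma 4.3 (slimness),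
applied to `Π_{[X/Aut X]}`. [cite: MochizukiAbsTopIII2015, Proposition 4.2 (i) proof p.106] -/
theorem isIdRigid_of_completion_normalizer
    [(Γ.subgroupOf (Subgroup.normalizer (Γ : Set N))).FiniteIndex]
    (h : ∀ y : completion (GrpCat.of (Subgroup.normalizer (Γ : Set N))),
      (∀ γ : Subgroup.normalizer (Γ : Set N), (γ : N) ∈ Γ →
        y * etaFn (GrpCat.of (Subgroup.normalizer (Γ : Set N))) γ =
          etaFn (GrpCat.of (Subgroup.normalizer (Γ : Set N))) γ * y) → y = 1) :
    IsIdRigid (LocObj Γ) :=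
  isIdRigid_of_centralFamiliesTrivial (centralFamiliesTrivial_of_completion_normalizer h)

end LocObj

end Literature.AnabelianGeometry.AbsoluteAnabelian
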